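import Summits.CriticalPhenomena.PercolationContinuityZ3.Theorems.PercNearOneGluingNoHeavyLowerTailTwoPartitionHallCore
import Summits.CriticalPhenomena.PercolationContinuityZ3.Theorems.PercNearOneGluingNoHeavyLowerTailTwoPartitionSplit
import Summits.CriticalPhenomena.PercolationContinuityZ3.Theorems.PercNearOneGluingNoHeavyLowerTailTwoPartitionFibre
import HarnessLib.Audit

/-!
# `NoHeavyLowerTail` (crux stmt-CriticalPhenomena-4575), master-family hierarchy P3 (gen 32): the core `ThreeSetHallD` as a POINT
# FUNCTIONAL of a nested pair of up-sets, and the LAYERED INDUCTIVE STEP — a two-shape certificate at one coordinate lifts the core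
# from `2^ι` to `2^(ι ⊕ Unit)`

Support file (seat `prim-masterthm-p3`; `--supports stmt-CriticalPhenomena-4575`; memo
`run/shared/lean/prim/prim-masterthm/FROM-prim-masterthm-p3-g32-HALL-CORE.md` §4, HIERARCHY §39).  Companion of `…TwoPartitionHallCore`
(`ThreeSetHallD ↔ ThreeSetHallG2 → ThreeSetAntipodal`) and `…TwoPartitionSplit` (`fib`, `sum_finset_unit`, `chi_fib_empty_le`).

THE POINT FUNCTIONAL (this work).  For a nested pair of up-sets `𝒴 ⊆ 𝒱` put `ℰ = 𝒱 ∖ 𝒴` and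
  `coreFn 𝒴 𝒱 S = 𝟙[S ∈ 𝒴] − 𝟙[Sᶜ ∈ 𝒱] + 𝟙[S ⊆ e and e' ⊆ Sᶜ for some e, e' ∈ ℰ]`      (values in `{−1, 0, 1}`);
`CoreOn τ` says `0 ≤ Σ_S 𝟙[S ∈ 𝒲] · coreFn 𝒴 𝒱 S` for all up-sets `𝒲, 𝒴 ⊆ 𝒱` of `2^τ`, and `CorePair` is the same over all `Fin n`.
**`corePair_iff_threeSetHallD`**: this is exactly the core conjecture of `…TwoPartitionHallCore` (the sum is
`#(𝒲∩𝒴) − #(𝒲∩𝒱ᶜˢ) + #(𝒲 ∩ ↓ℰ ∩ (↑ℰ)ᶜˢ)`; instantiate `ThreeSetHallD` at `𝒰 = ↑ℰ`, `𝒟 = ↓ℰ`, and conversely relax).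
**THE INDUCTIVE STEP** (`sum_chi_mul_nonneg_of_certificate`, `coreOn_sum_step`): on the ground set `ι ⊕ Unit` a parent functional `g`
splits into its two layers `g₀ e = g(e ⊎ ∅)`, `g₁ e = g(e ⊎ univ)`; if `h₀, h₁ : 2^ι → ℤ` are nonnegative against every up-set of `2^ι`
(e.g. `h_b = coreFn 𝒴'_b 𝒱'_b` for nested pairs in `2^ι`, given `CoreOn ι`, or `0`) and POINTWISE `h₁ ≤ g₁`, `h₀ + h₁ ≤ g₀ + g₁`, then
`Σ_S 𝟙[S∈𝒲] g S ≥ 0` for every up-set `𝒲` of `2^(ι ⊕ Unit)` (move the surplus `g₁ − h₁ ≥ 0` from the top layer down along `𝒲₀ ⊆ 𝒲₁`).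
So the whole Hall tower (`ThreeSetHallD ⇔ G″ ⇒ G ⇒ H ⇒ ThreeSetAntipodal ⇒ SQKD`) follows by induction on the dimension from the W-FREE
**certificate conjecture**: every nested pair `𝒴 ⊊ 𝒱` of `2^(ι ⊕ Unit)` has (after permuting coordinates) two nested pairs in `2^ι` whose
`coreFn`'s satisfy the two pointwise inequalities against the layers of `coreFn 𝒴 𝒱`.  EVIDENCE (not in the kernel; seat code
`oneshape_exact.c`, `canon_var.c`, `tcr7.c`, kit j285843): such certificates — even of the canonical form "`h₁ ∈ {coreFn (𝒴₁∩𝒱₀) 𝒱₀,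
coreFn 𝒴₀ 𝒱₀}`, `h₀ =` the largest admissible pair inside `𝒱₁`" — exist for EVERY nested pair of `2^[n]`, `n ≤ 5` (7 820 773 pairs at
n = 5), and for `4·10⁶` random pairs of `2^[7]`.
HONEST LABEL: a reformulation, an equivalence and an inductive-step theorem; the certificate conjecture, `ThreeSetHallD`, `ThreeSetAntipodal`
remain OPEN. [this work]
-/

namespace Summit.CriticalPhenomena.PercolationContinuityZ3.Theorems.TwoPartition

open Finset
open scoped FinsetFamily

/-! ### The point functional of the core -/

section coreFn
variable {τ : Type*} [DecidableEq τ] [Fintype τ]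

/-- The point functional of the core for a nested pair `𝒴 ⊆ 𝒱` (`ℰ = 𝒱 ∖ 𝒴`):
`𝟙[S ∈ 𝒴] − 𝟙[Sᶜ ∈ 𝒱] + 𝟙[S ⊆ e ∧ e' ⊆ Sᶜ for some e, e' ∈ ℰ]`. [this work] -/
def coreFn (𝒴 𝒱 : Finset (Finset τ)) (S : Finset τ) : ℤ :=
  chi 𝒴 S - chi 𝒱 Sᶜ + (if (∃ e ∈ 𝒱 \ 𝒴, S ⊆ e) ∧ (∃ e ∈ 𝒱 \ 𝒴, e ⊆ Sᶜ) then 1 else 0)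

/-- The core on a ground type `τ` (open for `|τ| ≥ 7`): `0 ≤ Σ_S 𝟙[S∈𝒲]·coreFn 𝒴 𝒱 S` for all up-sets `𝒲` and nested up-sets `𝒴 ⊆ 𝒱` of `2^τ`.
An obligation / hypothesis — never a fact. [this work] [status: open] -/
@[conjecture] def CoreOn (τ : Type*) [DecidableEq τ] [Fintype τ] : Prop :=
  ∀ (𝒲 𝒴 𝒱 : Finset (Finset τ)), IsUpperSet (𝒲 : Set (Finset τ)) → IsUpperSet (𝒴 : Set (Finset τ)) →
    IsUpperSet (𝒱 : Set (Finset τ)) → 𝒴 ⊆ 𝒱 → 0 ≤ ∑ S, chi 𝒲 S * coreFn 𝒴 𝒱 S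

/-- The correction family `{S : S ⊆ e ∧ e' ⊆ Sᶜ, e, e' ∈ ℰ} = ↓ℰ ∩ (↑ℰ)ᶜˢ`, written as a filter (no closure operators needed). [this work] -/
theorem coreFn_eq (𝒴 𝒱 : Finset (Finset τ)) (S : Finset τ) :
    coreFn 𝒴 𝒱 S = chi 𝒴 S - chi 𝒱ᶜˢ S
      + chi (univ.filter fun T : Finset τ => (∃ e ∈ 𝒱 \ 𝒴, T ⊆ e) ∧ (∃ e ∈ 𝒱 \ 𝒴, e ⊆ Tᶜ)) S := by
  unfold coreFn chi
  simp only [mem_compls, mem_filter, mem_univ, true_and]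

/-- The summed functional is the count `#(𝒲 ∩ 𝒴) − #(𝒲 ∩ 𝒱ᶜˢ) + #(𝒲 ∩ ↓ℰ ∩ (↑ℰ)ᶜˢ)`. [this work] -/
theorem sum_chi_mul_coreFn (𝒲 𝒴 𝒱 : Finset (Finset τ)) :
    ∑ S, chi 𝒲 S * coreFn 𝒴 𝒱 S = (#(𝒲 ∩ 𝒴) : ℤ) - #(𝒲 ∩ 𝒱ᶜˢ)
      + #(𝒲 ∩ univ.filter fun T : Finset τ => (∃ e ∈ 𝒱 \ 𝒴, T ⊆ e) ∧ (∃ e ∈ 𝒱 \ 𝒴, e ⊆ Tᶜ)) := by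
  simp only [coreFn_eq, mul_add, mul_sub, Finset.sum_add_distrib, Finset.sum_sub_distrib, ← chi_inter, ← card_eq_sum_chi]

end coreFn

/-! ### `CorePair ↔ ThreeSetHallD` -/

/-- The core over all finite cubes `2^[n]` in point-functional form (equivalent to `ThreeSetHallD`; open). An obligation / hypothesis — never a fact. [this work] [status: open] -/
@[conjecture] def CorePair : Prop := ∀ n : ℕ, CoreOn (Fin n)

/-- **`ThreeSetHallD → CorePair`** (this work): instantiate the core at `𝒰 = ↑ℰ`, `𝒟 = ↓ℰ` (as filters). [this work] -/
theorem corePair_of_threeSetHallD (h : ThreeSetHallD) : CorePair := by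
  intro n 𝒲 𝒴 𝒱 h𝒲 h𝒴 h𝒱 hYV
  rw [sum_chi_mul_coreFn]
  -- `𝒰 = ↑ℰ`, `𝒟 = ↓ℰ`
  set 𝒰 : Finset (Finset (Fin n)) := univ.filter fun T => ∃ e ∈ 𝒱 \ 𝒴, e ⊆ T with h𝒰def
  set 𝒟 : Finset (Finset (Fin n)) := univ.filter fun T => ∃ e ∈ 𝒱 \ 𝒴, T ⊆ e with h𝒟def
  have h𝒰 : IsUpperSet (𝒰 : Set (Finset (Fin n))) := by
    intro A B hAB hA
    rw [Finset.mem_coe, h𝒰def, mem_filter] at hA ⊢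
    obtain ⟨-, e, he, heA⟩ := hA
    exact ⟨mem_univ _, e, he, heA.trans hAB⟩
  have h𝒟 : IsLowerSet (𝒟 : Set (Finset (Fin n))) := by
    intro A B hBA hA
    rw [Finset.mem_coe, h𝒟def, mem_filter] at hA ⊢
    obtain ⟨-, e, he, hAe⟩ := hA
    exact ⟨mem_univ _, e, he, hBA.trans hAe⟩
  have hUV : 𝒰 ⊆ 𝒱 := by
    intro T hT
    rw [h𝒰def, mem_filter] at hT
    obtain ⟨-, e, he, heT⟩ := hT
    exact h𝒱 heT (mem_sdiff.1 he).1
  have hVD : 𝒱 ∩ 𝒟 ⊆ 𝒰 := by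
    intro T hT
    rw [mem_inter, h𝒟def, mem_filter] at hT
    obtain ⟨hTV, -, e, he, hTe⟩ := hT
    rw [h𝒰def, mem_filter]
    refine ⟨mem_univ _, T, mem_sdiff.2 ⟨hTV, fun hTY => ?_⟩, Subset.rfl⟩
    exact (mem_sdiff.1 he).2 (h𝒴 hTe hTY)
  have key := h n 𝒲 𝒰 𝒱 𝒟 h𝒲 h𝒰 h𝒱 h𝒟 hUV hVD
  unfold twoPartN at key
  -- `𝒲 ∩ 𝒟 ∩ 𝒰 = 𝒲 ∩ ℰ`, and the filter family is `𝒟 ∩ 𝒰ᶜˢ`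
  have e1 : 𝒲 ∩ 𝒟 ∩ 𝒰 = (𝒲 ∩ 𝒱) \ 𝒴 := by
    ext T
    simp only [mem_inter, mem_sdiff, h𝒟def, h𝒰def, mem_filter, mem_univ, true_and]
    constructor
    · rintro ⟨⟨hW, e, he, hTe⟩, e', he', he'T⟩
      have hTV : T ∈ 𝒱 := h𝒱 he'T he'.1
      exact ⟨⟨hW, hTV⟩, fun hTY => he.2 (h𝒴 hTe hTY)⟩
    · rintro ⟨⟨hW, hTV⟩, hTY⟩
      exact ⟨⟨hW, T, ⟨hTV, hTY⟩, Subset.rfl⟩, T, ⟨hTV, hTY⟩, Subset.rfl⟩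
  have e2 : 𝒲 ∩ 𝒟 ∩ 𝒰ᶜˢ = 𝒲 ∩ univ.filter (fun T : Finset (Fin n) => (∃ e ∈ 𝒱 \ 𝒴, T ⊆ e) ∧ (∃ e ∈ 𝒱 \ 𝒴, e ⊆ Tᶜ)) := by
    ext T
    simp only [mem_inter, mem_compls, h𝒟def, h𝒰def, mem_filter, mem_univ, true_and, and_assoc]
  have e3 : (#((𝒲 ∩ 𝒱) \ 𝒴) : ℤ) = #(𝒲 ∩ 𝒱) - #(𝒲 ∩ 𝒴) := by
    have hsub : 𝒲 ∩ 𝒴 ⊆ 𝒲 ∩ 𝒱 := inter_subset_inter_left (s := 𝒲) hYV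
    have := card_sdiff_add_card_eq_card hsub
    have e4 : (𝒲 ∩ 𝒱) \ (𝒲 ∩ 𝒴) = (𝒲 ∩ 𝒱) \ 𝒴 := by
      ext T; simp only [mem_sdiff, mem_inter, not_and]; tauto
    rw [e4] at this
    omega
  rw [e1, e2, e3] at key
  omega

/-- **`CorePair → ThreeSetHallD`** (this work): given `𝒰 ⊆ 𝒱`, `𝒟` with `𝒱 ∩ 𝒟 ⊆ 𝒰`, apply the point form to `𝒴 := 𝒱 ∖ 𝒟` and relax
`↓ℰ ⊆ 𝒟`, `(↑ℰ)ᶜˢ ⊆ 𝒰ᶜˢ`. [this work] -/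
theorem threeSetHallD_of_corePair (h : CorePair) : ThreeSetHallD := by
  intro n 𝒲 𝒰 𝒱 𝒟 h𝒲 h𝒰 h𝒱 h𝒟 hUV hVD
  have hY : IsUpperSet ((𝒱 \ 𝒟 : Finset (Finset (Fin n))) : Set (Finset (Fin n))) := by
    rw [coe_sdiff]; exact h𝒱.sdiff_of_isLowerSet h𝒟
  have key := h n 𝒲 (𝒱 \ 𝒟) 𝒱 h𝒲 hY h𝒱 sdiff_subset
  rw [sum_chi_mul_coreFn] at key
  unfold twoPartN
  -- `𝒱 \ (𝒱 \ 𝒟) = 𝒱 ∩ 𝒟 = 𝒟 ∩ 𝒰`-part:  `#(𝒲 ∩ (𝒱 \ 𝒟)) = #(𝒲 ∩ 𝒱) − #(𝒲 ∩ 𝒟 ∩ 𝒰)`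
  have hVD' : ∀ T, T ∈ 𝒱 → T ∈ 𝒟 → T ∈ 𝒰 := fun T hv hd => hVD (mem_inter.2 ⟨hv, hd⟩)
  have e1 : (#(𝒲 ∩ (𝒱 \ 𝒟)) : ℤ) = #(𝒲 ∩ 𝒱) - #(𝒲 ∩ 𝒟 ∩ 𝒰) := by
    have hsub : 𝒲 ∩ 𝒟 ∩ 𝒰 ⊆ 𝒲 ∩ 𝒱 := by
      intro T hT; simp only [mem_inter] at hT ⊢; exact ⟨hT.1.1, hUV hT.2⟩
    have := card_sdiff_add_card_eq_card hsub
    have e4 : (𝒲 ∩ 𝒱) \ (𝒲 ∩ 𝒟 ∩ 𝒰) = 𝒲 ∩ (𝒱 \ 𝒟) := by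
      ext T; simp only [mem_sdiff, mem_inter]
      constructor
      · rintro ⟨⟨hW, hV⟩, hn⟩; exact ⟨hW, hV, fun hD => hn ⟨⟨hW, hD⟩, hVD' T hV hD⟩⟩
      · rintro ⟨hW, hV, hnD⟩; exact ⟨⟨hW, hV⟩, fun h3 => hnD h3.1.2⟩
    rw [e4] at this
    omega
  -- the correction family is inside `𝒟 ∩ 𝒰ᶜˢ`
  have e2 : #(𝒲 ∩ univ.filter (fun T : Finset (Fin n) => (∃ e ∈ 𝒱 \ (𝒱 \ 𝒟), T ⊆ e) ∧ (∃ e ∈ 𝒱 \ (𝒱 \ 𝒟), e ⊆ Tᶜ)))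
      ≤ #(𝒲 ∩ 𝒟 ∩ 𝒰ᶜˢ) := by
    refine card_le_card fun T hT => ?_
    simp only [mem_inter, mem_filter, mem_univ, true_and, mem_compls] at hT ⊢
    obtain ⟨hW, ⟨e, he, hTe⟩, ⟨e', he', he'T⟩⟩ := hT
    have heD : e ∈ 𝒟 := by
      have := (mem_sdiff.1 he).2; rw [mem_sdiff, not_and, not_not] at this; exact this (mem_sdiff.1 he).1
    have he'D : e' ∈ 𝒟 := by
      have := (mem_sdiff.1 he').2; rw [mem_sdiff, not_and, not_not] at this; exact this (mem_sdiff.1 he').1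
    exact ⟨⟨hW, h𝒟 hTe heD⟩, h𝒰 he'T (hVD' e' (mem_sdiff.1 he').1 he'D)⟩
  omega

/-- Hence `CorePair ↔ ThreeSetHallD` (↔ `ThreeSetHallG2`, `…TwoPartitionHallCore`). [this work] -/
theorem corePair_iff_threeSetHallD : CorePair ↔ ThreeSetHallD :=
  ⟨threeSetHallD_of_corePair, corePair_of_threeSetHallD⟩

/-- `CorePair → ThreeSetAntipodal`. [this work] -/
theorem threeSetAntipodal_of_corePair (h : CorePair) : ThreeSetAntipodal :=
  threeSetAntipodal_of_threeSetHallD (threeSetHallD_of_corePair h)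

/-! ### The layered inductive step on `ι ⊕ Unit` -/

section Step
variable {ι : Type*} [DecidableEq ι] [Fintype ι]

/-- **Two-shape certificate ⟹ the parent functional is nonnegative against every up-set** (this work).  `g` is any function on
`2^(ι ⊕ Unit)`; `g₀ e = g (e ⊎ ∅)`, `g₁ e = g (e ⊎ univ)` are its layers; `h₀, h₁` are nonnegative against every up-set of `2^ι`;
pointwise `h₁ ≤ g₁` and `h₀ + h₁ ≤ g₀ + g₁`.  Then `Σ_S 𝟙[S ∈ 𝒲]·g S ≥ 0` for every up-set `𝒲` of `2^(ι ⊕ Unit)`: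
`Σ = Σ_e (χ₀ g₀ + χ₁ g₁) ≥ Σ_e (χ₀ (g₀ + g₁ − h₁) + χ₁ h₁) ≥ Σ_e χ₀ h₀ + Σ_e χ₁ h₁ ≥ 0` using `0 ≤ χ₀ ≤ χ₁` (layers of an up-set). [this work] -/
theorem sum_chi_mul_nonneg_of_certificate (g : Finset (ι ⊕ Unit) → ℤ) (h₀ h₁ : Finset ι → ℤ)
    (hh₀ : ∀ 𝒲' : Finset (Finset ι), IsUpperSet (𝒲' : Set (Finset ι)) → 0 ≤ ∑ e, chi 𝒲' e * h₀ e)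
    (hh₁ : ∀ 𝒲' : Finset (Finset ι), IsUpperSet (𝒲' : Set (Finset ι)) → 0 ≤ ∑ e, chi 𝒲' e * h₁ e)
    (hle₁ : ∀ e, h₁ e ≤ g (e.disjSum (univ : Finset Unit)))
    (hle₀ : ∀ e, h₀ e + h₁ e ≤ g (e.disjSum (∅ : Finset Unit)) + g (e.disjSum (univ : Finset Unit)))
    {𝒲 : Finset (Finset (ι ⊕ Unit))} (h𝒲 : IsUpperSet (𝒲 : Set (Finset (ι ⊕ Unit)))) :
    0 ≤ ∑ S, chi 𝒲 S * g S := by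
  rw [sum_finset_sum_eq]
  simp only [sum_finset_unit]
  have k0 := hh₀ (fib 𝒲 ∅) (isUpperSet_fib h𝒲 ∅)
  have k1 := hh₁ (fib 𝒲 univ) (isUpperSet_fib h𝒲 univ)
  simp only [chi_fib] at k0 k1
  have hpt : ∀ e : Finset ι, chi 𝒲 (e.disjSum ∅) * h₀ e + chi 𝒲 (e.disjSum univ) * h₁ e
      ≤ chi 𝒲 (e.disjSum ∅) * g (e.disjSum ∅) + chi 𝒲 (e.disjSum univ) * g (e.disjSum univ) := by
    intro e
    have hmono := chi_fib_empty_le h𝒲 e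
    have a := hle₁ e
    have b := hle₀ e
    rcases chi_zero_or_one 𝒲 (e.disjSum (∅ : Finset Unit)) with z0 | z0 <;>
      rcases chi_zero_or_one 𝒲 (e.disjSum (univ : Finset Unit)) with z1 | z1 <;>
      rw [z0, z1] at hmono ⊢ <;> nlinarith
  have hsum := Finset.sum_le_sum fun (e : Finset ι) (_ : e ∈ (univ : Finset (Finset ι))) => hpt e
  rw [Finset.sum_add_distrib] at hsum
  linarith

/-- **The inductive step for the core** (this work): if the core holds on `2^ι` and the parent pair `𝒴 ⊆ 𝒱` on `2^(ι ⊕ Unit)` admits two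
nested pairs `𝒴₀' ⊆ 𝒱₀'`, `𝒴₁' ⊆ 𝒱₁'` of up-sets of `2^ι` whose point functionals, scaled by `c₀, c₁ ∈ {0, 1}` (`0` = "no instance"),
satisfy the two pointwise certificate inequalities against the layers of `coreFn 𝒴 𝒱`, then the core holds for `(𝒲, 𝒴, 𝒱)` for every
up-set `𝒲` of `2^(ι ⊕ Unit)`. [this work] -/
theorem coreOn_sum_step (hι : CoreOn ι) {𝒴 𝒱 : Finset (Finset (ι ⊕ Unit))}
    {𝒴₀' 𝒱₀' 𝒴₁' 𝒱₁' : Finset (Finset ι)} (c₀ c₁ : ℤ) (hc₀ : c₀ = 0 ∨ c₀ = 1) (hc₁ : c₁ = 0 ∨ c₁ = 1)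
    (hY₀ : IsUpperSet (𝒴₀' : Set (Finset ι))) (hV₀ : IsUpperSet (𝒱₀' : Set (Finset ι))) (h₀sub : 𝒴₀' ⊆ 𝒱₀')
    (hY₁ : IsUpperSet (𝒴₁' : Set (Finset ι))) (hV₁ : IsUpperSet (𝒱₁' : Set (Finset ι))) (h₁sub : 𝒴₁' ⊆ 𝒱₁')
    (hle₁ : ∀ e, c₁ * coreFn 𝒴₁' 𝒱₁' e ≤ coreFn 𝒴 𝒱 (e.disjSum (univ : Finset Unit)))
    (hle₀ : ∀ e, c₀ * coreFn 𝒴₀' 𝒱₀' e + c₁ * coreFn 𝒴₁' 𝒱₁' e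
      ≤ coreFn 𝒴 𝒱 (e.disjSum (∅ : Finset Unit)) + coreFn 𝒴 𝒱 (e.disjSum (univ : Finset Unit)))
    {𝒲 : Finset (Finset (ι ⊕ Unit))} (h𝒲 : IsUpperSet (𝒲 : Set (Finset (ι ⊕ Unit)))) :
    0 ≤ ∑ S, chi 𝒲 S * coreFn 𝒴 𝒱 S := by
  refine sum_chi_mul_nonneg_of_certificate (coreFn 𝒴 𝒱) (fun e => c₀ * coreFn 𝒴₀' 𝒱₀' e) (fun e => c₁ * coreFn 𝒴₁' 𝒱₁' e)
    (fun 𝒲' h𝒲' => ?_) (fun 𝒲' h𝒲' => ?_) hle₁ hle₀ h𝒲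
  · have k := hι 𝒲' 𝒴₀' 𝒱₀' h𝒲' hY₀ hV₀ h₀sub
    have e : ∑ e, chi 𝒲' e * (c₀ * coreFn 𝒴₀' 𝒱₀' e) = c₀ * ∑ e, chi 𝒲' e * coreFn 𝒴₀' 𝒱₀' e := by
      rw [Finset.mul_sum]; exact Finset.sum_congr rfl fun e _ => by ring
    rw [e]; rcases hc₀ with h | h <;> rw [h] <;> nlinarith
  · have k := hι 𝒲' 𝒴₁' 𝒱₁' h𝒲' hY₁ hV₁ h₁sub
    have e : ∑ e, chi 𝒲' e * (c₁ * coreFn 𝒴₁' 𝒱₁' e) = c₁ * ∑ e, chi 𝒲' e * coreFn 𝒴₁' 𝒱₁' e := by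
      rw [Finset.mul_sum]; exact Finset.sum_congr rfl fun e _ => by ring
    rw [e]; rcases hc₁ with h | h <;> rw [h] <;> nlinarith

end Step

/-! ### Transport along a bijection of the ground set, and the induction from certificates -/

section Transport
variable {β γ : Type*} [DecidableEq β] [Fintype β] [DecidableEq γ] [Fintype γ]

omit [Fintype β] [Fintype γ] in
/-- Set differences are preserved by `famMap`. [this work] -/
theorem famMap_sdiff (e : β ≃ γ) (𝒳 𝒴 : Finset (Finset β)) : famMap e (𝒳 \ 𝒴) = famMap e 𝒳 \ famMap e 𝒴 := by
  ext t; simp only [mem_famMap, mem_sdiff]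

/-- The correction family `↓ℰ ∩ (↑ℰ)ᶜˢ` is transported by `famMap`. [this work] -/
theorem famMap_corr (e : β ≃ γ) (ℰ : Finset (Finset β)) :
    famMap e (univ.filter fun T : Finset β => (∃ a ∈ ℰ, T ⊆ a) ∧ (∃ a ∈ ℰ, a ⊆ Tᶜ))
      = univ.filter fun T : Finset γ => (∃ a ∈ famMap e ℰ, T ⊆ a) ∧ (∃ a ∈ famMap e ℰ, a ⊆ Tᶜ) := by
  ext t
  simp only [mem_famMap, mem_filter, mem_univ, true_and]
  have hc : tᶜ.map e.symm.toEmbedding = (t.map e.symm.toEmbedding)ᶜ := by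
    ext b; simp only [mem_map_equiv, Equiv.symm_symm, mem_compl]
  constructor
  · rintro ⟨⟨a, ha, hta⟩, ⟨a', ha', hat⟩⟩
    refine ⟨⟨a.map e.toEmbedding, by rw [map_map_symm]; exact ha, ?_⟩, ⟨a'.map e.toEmbedding, by rw [map_map_symm]; exact ha', ?_⟩⟩
    · have h1 := (map_subset_map (f := e.toEmbedding)).2 hta
      rw [map_symm_map] at h1; exact h1
    · rw [← hc] at hat
      have h1 := (map_subset_map (f := e.toEmbedding)).2 hat
      rw [map_symm_map] at h1; exact h1
  · rintro ⟨⟨a, ha, hta⟩, ⟨a', ha', hat⟩⟩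
    refine ⟨⟨a.map e.symm.toEmbedding, ha, (map_subset_map (f := e.symm.toEmbedding)).2 hta⟩,
      ⟨a'.map e.symm.toEmbedding, ha', ?_⟩⟩
    rw [← hc]; exact (map_subset_map (f := e.symm.toEmbedding)).2 hat

/-- The summed core functional is invariant under relabelling the ground set. [this work] -/
theorem sum_chi_mul_coreFn_famMap (e : β ≃ γ) (𝒲 𝒴 𝒱 : Finset (Finset β)) :
    ∑ S, chi (famMap e 𝒲) S * coreFn (famMap e 𝒴) (famMap e 𝒱) S = ∑ S, chi 𝒲 S * coreFn 𝒴 𝒱 S := by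
  rw [sum_chi_mul_coreFn, sum_chi_mul_coreFn, ← famMap_sdiff, ← famMap_corr, ← famMap_compls, ← famMap_inter, ← famMap_inter,
    ← famMap_inter, card_famMap, card_famMap, card_famMap]

omit [DecidableEq β] [Fintype β] [DecidableEq γ] [Fintype γ] in
/-- `famMap` preserves inclusion of families. [this work] -/
theorem famMap_subset (e : β ≃ γ) {𝒳 𝒴 : Finset (Finset β)} (h : 𝒳 ⊆ 𝒴) : famMap e 𝒳 ⊆ famMap e 𝒴 := fun t ht => by
  rw [mem_famMap] at ht ⊢; exact h ht

/-- **The core transports along any bijection of the ground set**: `CoreOn γ → CoreOn β` for `β ≃ γ`. [this work] -/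
theorem coreOn_of_equiv (e : β ≃ γ) (h : CoreOn γ) : CoreOn β := fun 𝒲 𝒴 𝒱 h𝒲 h𝒴 h𝒱 hYV => by
  rw [← sum_chi_mul_coreFn_famMap e]
  exact h _ _ _ (isUpperSet_famMap e h𝒲) (isUpperSet_famMap e h𝒴) (isUpperSet_famMap e h𝒱) (famMap_subset e hYV)

end Transport

section Induction

/-- **The CERTIFICATE CONJECTURE** (this work; open, W-FREE): every nested pair of up-sets `𝒴 ⊆ 𝒱` of `2^[n+1]` admits — after moving some
coordinate to the distinguished slot by a bijection `Fin (n+1) ≃ Fin n ⊕ Unit` — two nested pairs of up-sets of `2^[n]` (used or not,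
`c_b ∈ {0,1}`) whose point functionals satisfy the two pointwise certificate inequalities against the layers of the transported `coreFn 𝒴 𝒱`.
Verified (seat code) for all pairs on `2^[≤5]` — even with the canonical two-candidate rule — and on `4·10⁶` random pairs of `2^[7]`.
An obligation / hypothesis — never a fact. [this work] [status: open] -/
@[conjecture] def CoreCertificate : Prop :=
  ∀ (n : ℕ) (𝒴 𝒱 : Finset (Finset (Fin (n+1)))), IsUpperSet (𝒴 : Set (Finset (Fin (n+1)))) → IsUpperSet (𝒱 : Set (Finset (Fin (n+1)))) →
    𝒴 ⊆ 𝒱 →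
    ∃ (e : Fin (n+1) ≃ Fin n ⊕ Unit) (c₀ c₁ : ℤ) (𝒴₀' 𝒱₀' 𝒴₁' 𝒱₁' : Finset (Finset (Fin n))),
      (c₀ = 0 ∨ c₀ = 1) ∧ (c₁ = 0 ∨ c₁ = 1) ∧
      IsUpperSet (𝒴₀' : Set (Finset (Fin n))) ∧ IsUpperSet (𝒱₀' : Set (Finset (Fin n))) ∧ 𝒴₀' ⊆ 𝒱₀' ∧
      IsUpperSet (𝒴₁' : Set (Finset (Fin n))) ∧ IsUpperSet (𝒱₁' : Set (Finset (Fin n))) ∧ 𝒴₁' ⊆ 𝒱₁' ∧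
      (∀ a : Finset (Fin n), c₁ * coreFn 𝒴₁' 𝒱₁' a ≤ coreFn (famMap e 𝒴) (famMap e 𝒱) (a.disjSum (univ : Finset Unit))) ∧
      (∀ a : Finset (Fin n), c₀ * coreFn 𝒴₀' 𝒱₀' a + c₁ * coreFn 𝒴₁' 𝒱₁' a
        ≤ coreFn (famMap e 𝒴) (famMap e 𝒱) (a.disjSum (∅ : Finset Unit)) + coreFn (famMap e 𝒴) (famMap e 𝒱) (a.disjSum (univ : Finset Unit)))

/-- The core on the empty ground set (base of the induction): the only point is `∅` and `coreFn 𝒴 𝒱 ∅ ≥ 0` when `𝒴 ⊆ 𝒱` are up-sets. [this work] -/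
theorem coreOn_fin_zero : CoreOn (Fin 0) := by
  intro 𝒲 𝒴 𝒱 _ _ _ hYV
  refine Finset.sum_nonneg fun S _ => mul_nonneg (chi_nonneg 𝒲 S) ?_
  have hS : S = ∅ := eq_empty_of_forall_notMem fun x => x.elim0
  subst hS
  unfold coreFn chi
  have hc : (∅ : Finset (Fin 0))ᶜ = ∅ := eq_empty_of_forall_notMem fun x => x.elim0
  rw [hc]
  by_cases hY : (∅ : Finset (Fin 0)) ∈ 𝒴
  · rw [if_pos hY, if_pos (hYV hY)]; split_ifs <;> omega
  · rw [if_neg hY]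
    by_cases hV : (∅ : Finset (Fin 0)) ∈ 𝒱
    · rw [if_pos hV]
      have hex : (∃ a ∈ 𝒱 \ 𝒴, (∅ : Finset (Fin 0)) ⊆ a) ∧ (∃ a ∈ 𝒱 \ 𝒴, a ⊆ (∅ : Finset (Fin 0))) :=
        ⟨⟨∅, mem_sdiff.2 ⟨hV, hY⟩, Subset.rfl⟩, ⟨∅, mem_sdiff.2 ⟨hV, hY⟩, Subset.rfl⟩⟩
      rw [if_pos hex]; norm_num
    · rw [if_neg hV]; split_ifs <;> omega

/-- **The certificate conjecture implies the core for every finite cube** (induction on the dimension through `coreOn_sum_step` and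
the transport `coreOn_of_equiv`), hence `ThreeSetHallD`, `ThreeSetHallG2`, `ThreeSetHall`, `ThreeSetAntipodal` (and SQKD). [this work]
[status: conditional on `CoreCertificate`] -/
theorem corePair_of_coreCertificate (hC : CoreCertificate) : CorePair := by
  intro n
  induction n with
  | zero => exact coreOn_fin_zero
  | succ n ih =>
    -- the core on `Fin n ⊕ Unit`, then transport back to `Fin (n+1)` instance by instance
    intro 𝒲 𝒴 𝒱 h𝒲 h𝒴 h𝒱 hYV
    obtain ⟨e, c₀, c₁, 𝒴₀', 𝒱₀', 𝒴₁', 𝒱₁', hc₀, hc₁, hY₀, hV₀, h₀s, hY₁, hV₁, h₁s, hle₁, hle₀⟩ := hC n 𝒴 𝒱 h𝒴 h𝒱 hYV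
    rw [← sum_chi_mul_coreFn_famMap e]
    exact coreOn_sum_step ih c₀ c₁ hc₀ hc₁ hY₀ hV₀ h₀s hY₁ hV₁ h₁s hle₁ hle₀ (isUpperSet_famMap e h𝒲)

/-- `CoreCertificate → ThreeSetHallD`. [this work] [status: conditional on `CoreCertificate`] -/
theorem threeSetHallD_of_coreCertificate (hC : CoreCertificate) : ThreeSetHallD :=
  threeSetHallD_of_corePair (corePair_of_coreCertificate hC)

/-- `CoreCertificate → ThreeSetAntipodal`. [this work] [status: conditional on `CoreCertificate`] -/
theorem threeSetAntipodal_of_coreCertificate (hC : CoreCertificate) : ThreeSetAntipodal :=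
  threeSetAntipodal_of_corePair (corePair_of_coreCertificate hC)

end Induction

end Summit.CriticalPhenomena.PercolationContinuityZ3.Theorems.TwoPartition
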